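import Literature.NumberTheory.GaloisRepresentations.IdeleClassBarSInvariant
import HarnessLib

/-!
# The layers of `C_{K_S} = C̄^{N_S} ∈ C_{G_S}`: `C_{K_S}^{V̄_E} ≃ C_E` for `E ⊆ K_S`, `Hⁿ(G_S ⧸ V̄_E, C_{K_S}^{V̄_E}) ≅ Hⁿ(Gal(E/K), C_E)`,
# the transitions are the inflations `classInf`, and `C_{K_S} ↠ C̄_S` is `C_E ↠ C_S(E)` on the layers
# (NSW (8.3.7)–(8.3.9); Harari §17.1 Thm. 17.2; Serre, *Galois Cohomology* I §2.2 Prop. 8)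

Topic `NumberTheory/GaloisRepresentations`; namespace `Literature.NumberTheory.GaloisRepresentations.IdeleClassBar`.
Definitions with bodies (PLUMBING: `toLayerKS`, the layer module equivalence `layerKSAddEquiv`/`layerKSModuleEquiv` and the
induced isomorphism `layerKSCohomologyIso` on group cohomology — no new object) and theorems; NO named fact, no instance, no
notation, no `sorry`; number fields in `Type`.  Sequel to bsd-line-x1-p1-w3's `IdeleClassBarKS` (`classBarKSD K S = C_{K_S} =
C̄^{N_S} = ⋃_{E ⊆ K_S} C_E`, `toKS`, `exists_toKS`, `classBarKS_ρ_mk_toKS(_of_mem)`), `IdeleClassBarS` (`toClassBarSD :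
C_{K_S} ⟶ C̄_S`, `ofLayerS`) and `IdeleClassBarSLayers` (the layer subgroups `V̄_E = layerSubgroupS S E`, `quotLayerSEquiv :
G_S ⧸ V̄_E ≃* Gal(E/K)`, `layerSCohomologyIso` for `C̄_S`), to door-c5's `IdeleClassGroupLimitAction`
(`exists_ofLayer_eq_of_forall_mem_fixingSubgroup`: `C̄^{U_E} = C_E`) and to this seat's `IdeleClassBarSInvariant`
(`quotMap_comp_quotLayerSEquiv_symm`).  It is the `C_{K_S}`-twin of `IdeleClassBarSLayers`.

THE POINT.  For `E ⊆ K_S` the `V̄_E`-invariants of `C_{K_S}` are the `U_E`-invariants of `C̄`, i.e. `C_E` (Galois descent for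
idèle classes, Tate VII §8 / door-c5); equivariantly along `G_S ⧸ V̄_E ≃* Gal(E/K)`, so that door-c4's layer system of
`C_{K_S} ∈ C_{G_S}` has the cohomology `Hⁿ(Gal(E/K), C_E)` of the idèle class layers (§1–§3), its transitions `stepG` are the
inflations `classInf K E E'` (§4), and the projection `C_{K_S} ↠ C̄_S` reads `H•(π_E) : H•(Gal(E/K), C_E) → H•(Gal(E/K), C_S(E))`
on the layers (§5).  With these, the invariant map `inv_{K_S}` of `(G_S, C_{K_S})` (by descent of the `inv_{E/K}`) and its
compatibility with `inv_S` along `C_{K_S} ↠ C̄_S` follow in the sequel (`IdeleClassBarKSInvariant`).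

Cell `bsd-eis`, background lane «PT-Ш-S-TC» of crux `GoodLatticeBDPValue` (stmt-BirchSwinnertonDyer-19032), brick (★1) of
bsd-line-x1-p1-w6's F2D scoping (the left-hand identity of (R4)_S), seat bsd-line-x1-p1-w5 g10.  HONEST FRAMING: layer
bookkeeping; no duality theorem, no case of Poitou–Tate and no case of BSD is proved here.

## References
* J. Neukirch, A. Schmidt, K. Wingberg, *Cohomology of Number Fields* (2nd ed. 2008), VIII §3 (8.3.7)–(8.3.9). [NeukirchSchmidtWingberg2008]
* D. Harari, *Galois Cohomology and Class Field Theory* (2020), §13.1, §17.1 Thm. 17.2. [Harari2020]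
* J.-P. Serre, *Galois Cohomology* (1997), I §2.2 Proposition 8. [SerreGaloisCohomology1997]
* J. W. S. Cassels, A. Fröhlich (eds.), *Algebraic Number Theory* (1967), Ch. VII (J. Tate) §8 Prop. 8.1. [CasselsFrohlichANT1967]
-/

noncomputable section

open NumberField IsDedekindDomain CategoryTheory CategoryTheory.Limits groupCohomology
open Field (absoluteGaloisGroup)
open Literature.NumberTheory.Automorphic Literature.NumberTheory.Automorphic.IdeleClassGroup
open Literature.NumberTheory.NumberFields
open Literature.Algebra.Homology Literature.Algebra.Homology.DiscreteRep
open Literature.NumberTheory.GaloisRepresentations.LocalWeilDatum (galFixing)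
open scoped Classical

namespace Literature.NumberTheory.GaloisRepresentations

namespace IdeleClassBar

variable {K : Type} [Field K] [NumberField K] (S : Finset (HeightOneSpectrum (𝓞 K)))

/-! ## §1. The layer objects `C_{K_S}^{V̄_E}` and the map `C_E → C_{K_S}^{V̄_E}` -/

/-- **The layer object `C_{K_S}^{V̄_E}` of door-c4's system** for `C_{K_S} ∈ C_{G_S}` at `V̄_E` (`invariantsQuotFunctor`; an
abbreviation, so that `stepG`, `inflG`, `LayerColimit.desc` apply verbatim). [cite: SerreGaloisCohomology1997, I §2.2 Proposition 8] -/
abbrev layerRepKS (E : GalLayer K) :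
    Rep ℤ (GaloisGroupUnramifiedOutside K (↑S : Set (HeightOneSpectrum (𝓞 K))) ⧸
      (layerSubgroupS S E : Subgroup (GaloisGroupUnramifiedOutside K (↑S : Set (HeightOneSpectrum (𝓞 K)))))) :=
  (DiscreteRep.invariantsQuotFunctor ℤ
    (layerSubgroupS S E : Subgroup (GaloisGroupUnramifiedOutside K (↑S : Set (HeightOneSpectrum (𝓞 K)))))).obj (classBarKSD K S)

/-- The underlying vector of `[g] • z` in `C_{K_S}^{V̄_E}` is `g • z` (unfolding). [cite: Harari2020, §4.3 Remark 4.24] -/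
theorem coe_layerRepKS_ρ_mk (E : GalLayer K) (g : GaloisGroupUnramifiedOutside K (↑S : Set (HeightOneSpectrum (𝓞 K))))
    (z : (layerRepKS S E).V) :
    (((layerRepKS S E).ρ (QuotientGroup.mk g) z).1 : (classBarKS K S).V) = (classBarKS K S).ρ g z.1 := rfl

section Layer

variable {E : GalLayer K} (hE : ramificationSubgroup K (↑S : Set (HeightOneSpectrum (𝓞 K))) ≤ galFixing K E.1)

/-- The image `[x]_E ∈ C_{K_S}` of `x ∈ C_E` is fixed by `V̄_E` (`V̄_E` consists of the classes `[σ]`, `σ ∈ Gal(K̄/E)`).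
[cite: NeukirchSchmidtWingberg2008, VIII §3 (8.3.7)] -/
theorem toKS_mem_invariants_layerSubgroupS (x : layerClass K E) :
    toKS S hE x ∈ Representation.invariants ((classBarKSD K S).obj.ρ.comp
      (layerSubgroupS S E : Subgroup (GaloisGroupUnramifiedOutside K (↑S : Set (HeightOneSpectrum (𝓞 K))))).subtype) := by
  intro v
  obtain ⟨σ, hσ, hσv⟩ := (mem_layerSubgroupS_iff S E v.1).1 v.2
  change (classBarKS K S).ρ (v.1 : GaloisGroupUnramifiedOutside K (↑S : Set (HeightOneSpectrum (𝓞 K)))) (toKS S hE x) = toKS S hE x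
  rw [← hσv]
  exact classBarKS_ρ_mk_toKS_of_mem S hE hσ x

/-- **`C_E → C_{K_S}^{V̄_E}`, `x ↦ [x]_E`.** [cite: NeukirchSchmidtWingberg2008, VIII §3 (8.3.7)] -/
def toLayerKS : layerClass K E →+ (layerRepKS S E).V :=
  AddMonoidHom.mk' (fun x => ⟨toKS S hE x, toKS_mem_invariants_layerSubgroupS S hE x⟩) fun x y =>
    Subtype.ext (map_add (toKS S hE) x y)

/-- Formula: the underlying vector of `toLayerKS x` is `toKS x`. [cite: NeukirchSchmidtWingberg2008, VIII §3 (8.3.7)] -/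
@[simp] theorem coe_toLayerKS (x : layerClass K E) : ((toLayerKS S hE x).1 : (classBarKS K S).V) = toKS S hE x := rfl

/-- `C_E → C_{K_S}^{V̄_E}` is injective. [cite: CasselsFrohlichANT1967, Ch. VII §8 Prop. 8.1] -/
theorem toLayerKS_injective : Function.Injective (toLayerKS S hE) :=
  fun _ _ h => toKS_injective S hE (congrArg Subtype.val h)

/-- **`C_E → C_{K_S}^{V̄_E}` is onto**: a `V̄_E`-invariant of `C_{K_S}` is an element of `C̄` fixed by `Gal(K̄/E)`, hence comes
from `C_E` (door-c5's Galois descent `exists_ofLayer_eq_of_forall_mem_fixingSubgroup`).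
[cite: CasselsFrohlichANT1967, Ch. VII §8 Prop. 8.1][cite: NeukirchSchmidtWingberg2008, VIII §3 (8.3.7)] -/
theorem toLayerKS_surjective : Function.Surjective (toLayerKS S hE) := by
  intro z
  have hz : ∀ σ ∈ E.1.fixingSubgroup, barRep K σ (z.1.1 : classBar K) = z.1.1 := by
    intro σ hσ
    have hσ' : σ ∈ galFixing K E.1 := hσ
    have h := congrArg (fun w : (classBarKS K S).V => (w.1 : classBar K))
      (z.2 ⟨QuotientGroup.mk σ, mk_mem_layerSubgroupS S E hσ'⟩)
    exact h
  obtain ⟨x, hx⟩ := exists_ofLayer_eq_of_forall_mem_fixingSubgroup E z.1.1 hz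
  exact ⟨x, Subtype.ext (Subtype.ext hx)⟩

/-- **Equivariance**: `[[σ]] • [x]_E = [σ|_E • x]_E`. [cite: NeukirchSchmidtWingberg2008, VIII §3 (8.3.8)] -/
theorem layerRepKS_ρ_mk_mk_toLayerKS (σ : absoluteGaloisGroup K) (x : layerClass K E) :
    (layerRepKS S E).ρ (QuotientGroup.mk (QuotientGroup.mk σ)) (toLayerKS S hE x) = toLayerKS S hE (layerAct K E σ x) :=
  Subtype.ext (classBarKS_ρ_mk_toKS S σ hE x)

/-! ## §2. The layer module `C_{K_S}^{V̄_E} ≃ₗ[ℤ] C_E` -/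

/-- **`C_{K_S}^{V̄_E} ≃+ C_E`** (the inverse of the bijection `toLayerKS`). [cite: CasselsFrohlichANT1967, Ch. VII §8 Prop. 8.1] -/
def layerKSAddEquiv : (layerRepKS S E).V ≃+ layerClass K E :=
  (AddEquiv.ofBijective (toLayerKS S hE) ⟨toLayerKS_injective S hE, toLayerKS_surjective S hE⟩).symm

/-- Formula: `layerKSAddEquiv [x]_E = x`. [cite: CasselsFrohlichANT1967, Ch. VII §8 Prop. 8.1] -/
theorem layerKSAddEquiv_toLayerKS (x : layerClass K E) : layerKSAddEquiv S hE (toLayerKS S hE x) = x :=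
  (AddEquiv.ofBijective (toLayerKS S hE) ⟨toLayerKS_injective S hE, toLayerKS_surjective S hE⟩).symm_apply_apply x

/-- Formula: `layerKSAddEquiv⁻¹ x = [x]_E`. [cite: CasselsFrohlichANT1967, Ch. VII §8 Prop. 8.1] -/
theorem layerKSAddEquiv_symm_apply (x : layerClass K E) : (layerKSAddEquiv S hE).symm x = toLayerKS S hE x := rfl

/-- **The layer module `C_{K_S}^{V̄_E} ≃ₗ[ℤ] C_E`** (for the `ℤ`-module structures carried by the two `Rep` objects, so that Mathlib's
`groupCohomology.mapIso` applies verbatim). [cite: NeukirchSchmidtWingberg2008, VIII §3 (8.3.8)] -/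
def layerKSModuleEquiv :
    letI := (layerRepKS S E).hV2
    letI := (haveI := E.numberField; IdeleClassGroup.galoisRep K E.1).hV2
    (layerRepKS S E).V ≃ₗ[ℤ] layerClass K E := by
  letI := (layerRepKS S E).hV2
  letI := (haveI := E.numberField; IdeleClassGroup.galoisRep K E.1).hV2
  exact
    { layerKSAddEquiv S hE with
      map_smul' := fun c z => by
        simp only [AddEquiv.toFun_eq_coe, RingHom.id_apply]
        exact (congrArg (layerKSAddEquiv S hE) (Int.cast_smul_eq_zsmul ℤ c z)).trans
          ((map_zsmul (layerKSAddEquiv S hE) c z).trans (Int.cast_smul_eq_zsmul ℤ c (layerKSAddEquiv S hE z)).symm) }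

/-- Formula: `layerKSModuleEquiv [x]_E = x`. [cite: NeukirchSchmidtWingberg2008, VIII §3 (8.3.8)] -/
theorem layerKSModuleEquiv_toLayerKS (x : layerClass K E) : layerKSModuleEquiv S hE (toLayerKS S hE x) = x := by
  letI := (layerRepKS S E).hV2
  letI := (haveI := E.numberField; IdeleClassGroup.galoisRep K E.1).hV2
  exact layerKSAddEquiv_toLayerKS S hE x

/-- `σ|_E • x` in `C_E` is the representation `galoisRep K E` at `σ|_E` (unfolding door-c5's `layerAct`).
[cite: Harari2020, §13.1] -/
theorem layerAct_eq_galoisRep_ρ (σ : absoluteGaloisGroup K) (x : layerClass K E) :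
    layerAct K E σ x = (haveI := E.numberField; haveI := E.isGalois;
      (IdeleClassGroup.galoisRep K E.1).ρ (GalLayer.restrictHom E σ) x) := rfl

/-- **Equivariance of `layerKSModuleEquiv` along `quotLayerSEquiv : G_S ⧸ V̄_E ≃* Gal(E/K)`**: `layerKSModuleEquiv (g • z) =
(quotLayerSEquiv g) • layerKSModuleEquiv z` — the hypothesis of `groupCohomology.mapIso`.
[cite: NeukirchSchmidtWingberg2008, VIII §3 (8.3.8)][cite: SerreGaloisCohomology1997, I §2.2 Proposition 8] -/
theorem layerKSModuleEquiv_comm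
    (g : GaloisGroupUnramifiedOutside K (↑S : Set (HeightOneSpectrum (𝓞 K))) ⧸
      (layerSubgroupS S E : Subgroup (GaloisGroupUnramifiedOutside K (↑S : Set (HeightOneSpectrum (𝓞 K)))))) :
    letI := (layerRepKS S E).hV2; letI := (haveI := E.numberField; IdeleClassGroup.galoisRep K E.1).hV2;
    (layerKSModuleEquiv S hE).toLinearMap ∘ₗ (layerRepKS S E).ρ g =
      (haveI := E.numberField; (IdeleClassGroup.galoisRep K E.1).ρ (quotLayerSEquiv S hE g)) ∘ₗ
        (layerKSModuleEquiv S hE).toLinearMap := by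
  haveI := E.numberField
  haveI := E.isGalois
  letI := (layerRepKS S E).hV2
  letI := (IdeleClassGroup.galoisRep K E.1).hV2
  induction g using QuotientGroup.induction_on with
  | H u =>
    induction u using QuotientGroup.induction_on with
    | H σ =>
      refine LinearMap.ext fun z => ?_
      obtain ⟨x, rfl⟩ := toLayerKS_surjective S hE z
      change layerKSModuleEquiv S hE ((layerRepKS S E).ρ (QuotientGroup.mk (QuotientGroup.mk σ)) (toLayerKS S hE x)) =
        (IdeleClassGroup.galoisRep K E.1).ρ (quotLayerSEquiv S hE (QuotientGroup.mk (QuotientGroup.mk σ)))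
          (layerKSModuleEquiv S hE (toLayerKS S hE x))
      rw [quotLayerSEquiv_mk_mk, layerRepKS_ρ_mk_mk_toLayerKS, layerKSModuleEquiv_toLayerKS, layerKSModuleEquiv_toLayerKS]
      rfl

/-! ## §3. `Hⁿ(G_S ⧸ V̄_E, C_{K_S}^{V̄_E}) ≅ Hⁿ(Gal(E/K), C_E)` -/

/-- **The layers of `C_{K_S}` have the cohomology of the idèle class layers: `Hⁿ(G_S ⧸ V̄_E, C_{K_S}^{V̄_E}) ≅ Hⁿ(Gal(E/K), C_E)`**
(Mathlib `groupCohomology.mapIso` along `quotLayerSEquiv`, `layerKSModuleEquiv`).  NSW (8.3.7): `Hʳ(G_S, C_{K_S}) = lim→_E Hʳ(Gal(E/K), C_E)`.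
[cite: NeukirchSchmidtWingberg2008, VIII §3 (8.3.7)][cite: SerreGaloisCohomology1997, I §2.2 Proposition 8] -/
def layerKSCohomologyIso (n : ℕ) :
    groupCohomology (layerRepKS S E) n ≅ groupCohomology (haveI := E.numberField; IdeleClassGroup.galoisRep K E.1) n :=
  haveI := E.numberField
  groupCohomology.mapIso (quotLayerSEquiv S hE) (layerKSModuleEquiv S hE) (layerKSModuleEquiv_comm S hE) n

end Layer

/-! ## §4. The transitions are the inflations `classInf` -/

section Transition

variable {E E' : GalLayer K} (h : E ≤ E')
  (hE : ramificationSubgroup K (↑S : Set (HeightOneSpectrum (𝓞 K))) ≤ galFixing K E.1)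
  (hE' : ramificationSubgroup K (↑S : Set (HeightOneSpectrum (𝓞 K))) ≤ galFixing K E'.1)

/-- Door-c4's inclusion `C_{K_S}^{V̄_E} ⊆ C_{K_S}^{V̄_{E'}}` sends `[x]_E` to `[x_{E'}]_{E'}` (door-c5's transition `transHom`).
[cite: NeukirchSchmidtWingberg2008, VIII §3 (8.3.7)] -/
theorem invariantsStepIncl_toLayerKS (x : layerClass K E) :
    (DiscreteRep.invariantsStepIncl
        (layerSubgroupS S E : Subgroup (GaloisGroupUnramifiedOutside K (↑S : Set (HeightOneSpectrum (𝓞 K)))))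
        (layerSubgroupS S E' : Subgroup (GaloisGroupUnramifiedOutside K (↑S : Set (HeightOneSpectrum (𝓞 K)))))
        (layerSubgroupS_anti S h) (classBarKSD K S)).hom (toLayerKS S hE x) = toLayerKS S hE' (transHom E E' h x) :=
  Subtype.ext (toKS_transHom S h hE hE' x).symm

/-- Door-c5's transition `transHom` IS the base change `classInflHom` on vectors (`transHom_eq_baseChangeHom`).
[cite: Harari2020, §13.1][cite: CasselsFrohlichANT1967, Ch. VII §8 Prop. 8.1] -/
theorem transHom_eq_classInflHom_hom (x : layerClass K E) :
    transHom E E' h x = (haveI := E.numberField; haveI := E'.numberField; haveI := E.isGalois;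
      letI := GalLayer.algebraOfLE h; haveI := GalLayer.isScalarTower_of_le h;
      (IdeleCohomology.classInflHom K E.1 E'.1).hom x) := by
  rw [transHom_eq_baseChangeHom]
  rfl

set_option maxHeartbeats 800000 in
-- two `groupCohomology.map` composites compared through `map_comp` / `map_congr'` (as in `stepG_comp_layerSCohomologyIso`)
/-- **`stepG (V̄_E) (V̄_{E'}) ≫ iso_{E'} = iso_E ≫ classInf K E E' n`**: door-c4's transition between the layers of `C_{K_S}` is, under
the layer isomorphisms, the inflation `Hⁿ(Gal(E/K), C_E) → Hⁿ(Gal(E'/K), C_{E'})` of the idèle class layers.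
[cite: SerreGaloisCohomology1997, I §2.2 Proposition 8][cite: NeukirchSchmidtWingberg2008, VIII §3 (8.3.7)] -/
theorem stepG_comp_layerKSCohomologyIso (n : ℕ) :
    haveI := E.numberField; haveI := E'.numberField; haveI := E.isGalois; letI := GalLayer.algebraOfLE h;
    haveI := GalLayer.isScalarTower_of_le h;
    LayerColimit.stepG (layerSubgroupS S E) (layerSubgroupS S E') (layerSubgroupS_anti S h) (classBarKSD K S) n ≫
        (layerKSCohomologyIso S hE' n).hom =
      (layerKSCohomologyIso S hE n).hom ≫ IdeleCohomology.classInf K E.1 E'.1 n := by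
  haveI := E.numberField
  haveI := E'.numberField
  haveI := E.isGalois
  haveI := E'.isGalois
  letI := GalLayer.algebraOfLE h
  haveI := GalLayer.isScalarTower_of_le h
  rw [layerKSCohomologyIso, layerKSCohomologyIso, groupCohomology.mapIso_hom, groupCohomology.mapIso_hom,
    IdeleCohomology.classInf, ← groupCohomology.map_comp, ← groupCohomology.map_comp]
  refine Literature.Algebra.Homology.map_congr' (quotMap_comp_quotLayerSEquiv_symm S h hE hE') _ _ (fun z => ?_) n
  obtain ⟨x, rfl⟩ := toLayerKS_surjective S hE z
  change layerKSModuleEquiv S hE'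
      ((DiscreteRep.invariantsStepIncl _ _ (layerSubgroupS_anti S h) (classBarKSD K S)).hom (toLayerKS S hE x)) =
    (IdeleCohomology.classInflHom K E.1 E'.1).hom (layerKSModuleEquiv S hE (toLayerKS S hE x))
  rw [invariantsStepIncl_toLayerKS S h hE hE', layerKSModuleEquiv_toLayerKS, layerKSModuleEquiv_toLayerKS]
  exact transHom_eq_classInflHom_hom h x

/-- Elementwise form of the transition square. [cite: SerreGaloisCohomology1997, I §2.2 Proposition 8] -/
theorem layerKSCohomologyIso_hom_stepG (n : ℕ) (c : groupCohomology (layerRepKS S E) n) :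
    haveI := E.numberField; haveI := E'.numberField; haveI := E.isGalois; letI := GalLayer.algebraOfLE h;
    haveI := GalLayer.isScalarTower_of_le h;
    (layerKSCohomologyIso S hE' n).hom
        (LayerColimit.stepG (layerSubgroupS S E) (layerSubgroupS S E') (layerSubgroupS_anti S h) (classBarKSD K S) n c) =
      IdeleCohomology.classInf K E.1 E'.1 n ((layerKSCohomologyIso S hE n).hom c) := by
  have hsq := congrArg (fun φ => φ c) (stepG_comp_layerKSCohomologyIso S h hE hE' n)
  simpa only [ModuleCat.comp_apply] using hsq

end Transition

/-! ## §5. The projection `C_{K_S} ↠ C̄_S` on the layers is `π_E : C_E ↠ C_S(E)` -/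

section Projection

variable {E : GalLayer K} (hE : ramificationSubgroup K (↑S : Set (HeightOneSpectrum (𝓞 K))) ≤ galFixing K E.1)

/-- `C_{K_S}^{V̄_E} → C̄_S^{V̄_E}` (door-c4's functor on `toClassBarSD`) sends `[x]_E` to w3's `toLayerS x`.
[cite: Harari2020, Def. 15.38, §17.1 Thm. 17.2] -/
theorem invariantsQuotFunctor_map_toClassBarSD_toLayerKS (x : layerClass K E) :
    ((DiscreteRep.invariantsQuotFunctor ℤ
        (layerSubgroupS S E : Subgroup (GaloisGroupUnramifiedOutside K (↑S : Set (HeightOneSpectrum (𝓞 K)))))).map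
        (toClassBarSD K S)).hom (toLayerKS S hE x) = toLayerS S hE x :=
  Subtype.ext rfl

set_option maxHeartbeats 800000 in
-- as in §4
/-- **`Hⁿ(𝟙, (C_{K_S} ↠ C̄_S)^{V̄_E}) ≫ iso^S_E = iso^{KS}_E ≫ Hⁿ(π_E)`**: on the layers, the projection `C_{K_S} ↠ C̄_S` is
`π_E : C_E ↠ C_S(E) = C_E ⧸ U_{E,S}` (under w3's `layerSCohomologyIso` and `layerKSCohomologyIso`).
[cite: Harari2020, §17.1 Thm. 17.2 (proof)][cite: NeukirchSchmidtWingberg2008, VIII §3 (8.3.8)] -/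
theorem map_toClassBarSD_comp_layerSCohomologyIso (n : ℕ) :
    haveI := E.numberField;
    groupCohomology.map (MonoidHom.id _)
        ((DiscreteRep.invariantsQuotFunctor ℤ
          (layerSubgroupS S E : Subgroup (GaloisGroupUnramifiedOutside K (↑S : Set (HeightOneSpectrum (𝓞 K)))))).map
          (toClassBarSD K S)) n ≫ (layerSCohomologyIso S hE n).hom =
      (layerKSCohomologyIso S hE n).hom ≫ groupCohomology.map (MonoidHom.id _)
        (cokernel.π (IdeleCohomology.unitsOffToClass (F := K) (E := E.1) S) :
          IdeleClassGroup.galoisRep K E.1 ⟶ IdeleCohomology.classModUnitsRep K E.1 S) n := by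
  haveI := E.numberField
  rw [layerSCohomologyIso, layerKSCohomologyIso, groupCohomology.mapIso_hom, groupCohomology.mapIso_hom,
    ← groupCohomology.map_comp, ← groupCohomology.map_comp]
  refine Literature.Algebra.Homology.map_congr' (MonoidHom.ext fun _ => rfl) _ _ (fun z => ?_) n
  obtain ⟨x, rfl⟩ := toLayerKS_surjective S hE z
  change layerSModuleEquiv S hE
      (((DiscreteRep.invariantsQuotFunctor ℤ
        (layerSubgroupS S E : Subgroup (GaloisGroupUnramifiedOutside K (↑S : Set (HeightOneSpectrum (𝓞 K)))))).map
        (toClassBarSD K S)).hom (toLayerKS S hE x)) =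
    (cokernel.π (IdeleCohomology.unitsOffToClass (F := K) (E := E.1) S)).hom (layerKSModuleEquiv S hE (toLayerKS S hE x))
  rw [invariantsQuotFunctor_map_toClassBarSD_toLayerKS, layerSModuleEquiv_toLayerS, layerKSModuleEquiv_toLayerKS]

/-- Elementwise form: `iso^S_E (Hⁿ(𝟙, π^{V̄_E}) c) = Hⁿ(π_E) (iso^{KS}_E c)`. [cite: Harari2020, §17.1 Thm. 17.2 (proof)] -/
theorem layerSCohomologyIso_hom_map_toClassBarSD (n : ℕ) (c : groupCohomology (layerRepKS S E) n) :
    haveI := E.numberField;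
    (layerSCohomologyIso S hE n).hom (groupCohomology.map (MonoidHom.id _)
        ((DiscreteRep.invariantsQuotFunctor ℤ
          (layerSubgroupS S E : Subgroup (GaloisGroupUnramifiedOutside K (↑S : Set (HeightOneSpectrum (𝓞 K)))))).map
          (toClassBarSD K S)) n c) =
      groupCohomology.map (MonoidHom.id _)
        (cokernel.π (IdeleCohomology.unitsOffToClass (F := K) (E := E.1) S) :
          IdeleClassGroup.galoisRep K E.1 ⟶ IdeleCohomology.classModUnitsRep K E.1 S) n ((layerKSCohomologyIso S hE n).hom c) := by
  haveI := E.numberField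
  change (groupCohomology.map (MonoidHom.id _)
      ((DiscreteRep.invariantsQuotFunctor ℤ
        (layerSubgroupS S E : Subgroup (GaloisGroupUnramifiedOutside K (↑S : Set (HeightOneSpectrum (𝓞 K)))))).map
        (toClassBarSD K S)) n ≫ (layerSCohomologyIso S hE n).hom) c =
    ((layerKSCohomologyIso S hE n).hom ≫ groupCohomology.map (MonoidHom.id _)
      (cokernel.π (IdeleCohomology.unitsOffToClass (F := K) (E := E.1) S) :
        IdeleClassGroup.galoisRep K E.1 ⟶ IdeleCohomology.classModUnitsRep K E.1 S) n) c
  rw [map_toClassBarSD_comp_layerSCohomologyIso S hE n]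
  rfl

end Projection

end IdeleClassBar

end Literature.NumberTheory.GaloisRepresentations

end
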